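import Summits.BirchSwinnertonDyer.BirchSwinnertonDyer.Theorems.PrintCFramBottomClassIndexLawFiveLeFlipRungTwoOfJMLGlue
import Summits.BirchSwinnertonDyer.BirchSwinnertonDyer.Theorems.PrintCFramBottomClassIndexLawFiveLeFlipRungTwoEightOfJML
import Summits.BirchSwinnertonDyer.BirchSwinnertonDyer.Theorems.PrintCFramBottomClassIndexLawFiveLeFlipRungTwoModularAssembly
import Literature.NumberTheory.ModularForms.CohenEisensteinSeriesModularity
import Literature.NumberTheory.ModularForms.KatzQExpansionPrincipleCusps
import Literature.NumberTheory.ModularForms.ModPModularFormsThetaFiltration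
import HarnessLib

/-!
# Crux `PrintCFram.BottomClassIndexLawFiveLe` (stmt-BirchSwinnertonDyer-20372), line `eisenstein-resource-bdp-line` (registry v29
# `stub_flipRungs.2` / v30 `stub_flipRungTwo` = (FlipRungTwo⁶)): THE 2-ADIC FLIPPED-CUSP RUNG FROM THE PRINTED FACTS, e = 2 HALF CLOSED —
# (FlipRungTwo⁶) ⟸ NF-A ∧ NF-Q ∧ (JMLTwoEight⁶)
# (cell `bsd-print-cfram`, width seat `bsd-line-cfram-p1-w6` g10; THEOREMS ONLY, `--supports` 20372; BSD is not proved by any of this)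

HONEST FRAMING. Nothing here is a statement about BSD; no registered stub is closed by this file (registration is LEAD's). One-line
compositions of landed pieces: w7 g9's e = 2 modular assembly `jmlTwo_six_of_facts : NF-A → NF-Q → (JMLTwo⁶)` (`…FlipRungTwoModularAssembly`),
this seat's `flipRungTwo_six_of_jmlTwo_of_eight` (p714838) and `rungTwoEight_six_of_jmlTwoEight` (p715127). RESULT: the 2-adic flipped-cusp rung
(FlipRungTwo⁶) follows from the two printed facts NF-A (Cohen 1975 Thm 3.1), NF-Q (Katz 1973 Cor. 1.6.2) and ONE residual modular-free statement,
the e = 3 interface (JMLTwoEight⁶) (whose modular proof `jmlTwoEight_six_of_facts` is w8 g10's P6-M, in flight) — or, in Cohen-number currency,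
(RungTwo⁶)∣_{8 ∣ m}. So an interim v30 can read `stub_flipRungTwo := flipRungTwo_six_of_printsCohenKatzCusps_of_jmlTwoEight
stub_printsCohenKatzCusps stub_jmlTwoEight`. No definitions, no named facts, no `sorry`. beyond-print theorem: NO (composition).
-/

set_option autoImplicit false
-- summit-side namespace `Summit.BirchSwinnertonDyer.BirchSwinnertonDyer.…` (single-conjunct summit, D-0017 layout)
set_option linter.dupNamespace false

noncomputable section

open scoped Classical NumberTheorySymbols
open NumberField DirichletCharacter Literature.NumberTheory.LFunctions
  Literature.NumberTheory.ModularForms.CohenEisenstein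
  Literature.NumberTheory.EllipticCurves Literature.NumberTheory.EllipticCurves.KrizLi2019
  Literature.NumberTheory.QuadraticFields

namespace Summit.BirchSwinnertonDyer.BirchSwinnertonDyer.Theorems.PrintCFram.FlipRung

/-- **(FlipRungTwo⁶) ⟸ NF-A ∧ NF-Q ∧ (RungTwo⁶)∣_{8 ∣ m}** (the e = 2 half closed by w7 g9's `jmlTwo_six_of_facts`; the e = 3 half in
Cohen-number currency as the residue). [cite: Cohen1975, Thm. 3.1] [cite: Katz1973, §1.6 Cor. 1.6.2] -/
theorem flipRungTwo_six_of_facts_of_rungTwoEight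
    (hA : Literature.NumberTheory.ModularForms.Cohen1975.thm31_cohenSeries_mem_halfIntModularForms)
    (hQ : Literature.NumberTheory.ModularForms.Katz1973_qExpansionPrinciple_allCusps)
    (hEight :
    ∀ (p : ℕ) [Fact p.Prime] (m : ℕ) [NeZero m] (χ : DirichletCharacter ℚ_[p] m) (k : ℕ),
      (p = 7 ∨ p = 11 ∨ p = 19 ∨ p = 43 ∨ p = 67 ∨ p = 163) →
      m.Coprime p → χ.IsPrimitive → χ.IsQuadratic → (k = (p + 1) / 4 ∨ k = (3 * p - 1) / 4) →
      2 ≤ k → k ≤ p - 2 → χ (-1) * (-1) ^ k = -1 → 2 ∣ m → 8 ∣ m →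
      ∀ (τ : ℕ → ℤ), (∀ q' : ℕ, q'.Prime → q' ∣ m → q' ≠ 2 → (τ q' = 1 ∨ τ q' = -1)) →
      (∀ a : ℕ, m ∣ a → a / m % 4 = 3 →
        (∀ q' : ℕ, q'.Prime → q' ∣ m → q' ≠ 2 → jacobiSym (-((a / m : ℕ) : ℤ)) q' = τ q') →
        a / m % 8 = 7 → ¬ 3 ∣ a / m → ‖((cohenH k a : ℚ) : ℚ_[p])‖ ≤ (p : ℝ)⁻¹) →
      ∀ a : ℕ, m ∣ a → a / m % 4 = 3 →
        (∀ q' : ℕ, q'.Prime → q' ∣ m → q' ≠ 2 → jacobiSym (-((a / m : ℕ) : ℤ)) q' = τ q') →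
        a / m % 8 = 3 → ¬ 3 ∣ a / m → ‖((cohenH k a : ℚ) : ℚ_[p])‖ ≤ (p : ℝ)⁻¹) :
    ∀ (p : ℕ) [Fact p.Prime] (m : ℕ) [NeZero m] (χ : DirichletCharacter ℚ_[p] m) (k : ℕ),
      (p = 7 ∨ p = 11 ∨ p = 19 ∨ p = 43 ∨ p = 67 ∨ p = 163) →
      m.Coprime p → χ.IsPrimitive → χ.IsQuadratic → (k = (p + 1) / 4 ∨ k = (3 * p - 1) / 4) →
      2 ≤ k → k ≤ p - 2 → χ (-1) * (-1) ^ k = -1 → 2 ∣ m →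
      ∀ (τ : ℕ → ℤ), (∀ q' : ℕ, q'.Prime → q' ∣ m → q' ≠ 2 → (τ q' = 1 ∨ τ q' = -1)) →
      (∀ (K₀ : Type) [Field K₀] [NumberField K₀] (ε₀ : DirichletCharacter ℚ_[p] (NumberField.discr K₀).natAbs),
        IsImaginaryQuadratic K₀ → Odd (NumberField.discr K₀) → NumberField.discr K₀ < -4 →
        ¬ ((3 : ℤ) ∣ NumberField.discr K₀) →
        (∀ q' : ℕ, q'.Prime → q' ∣ m → q' ≠ 2 → jacobiSym (NumberField.discr K₀) q' = τ q') →
        NumberField.discr K₀ % 8 = 1 → IsKroneckerCharacterOf K₀ ε₀ →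
        ‖(k : ℚ_[p])⁻¹ * @generalizedBernoulli ℚ_[p] _ _
            (changeLevel (dvd_mul_right m (NumberField.discr K₀).natAbs) χ *
              changeLevel (dvd_mul_left (NumberField.discr K₀).natAbs m) ε₀).conductor ⟨conductor_ne_zero _⟩ k
            (changeLevel (dvd_mul_right m (NumberField.discr K₀).natAbs) χ *
              changeLevel (dvd_mul_left (NumberField.discr K₀).natAbs m) ε₀).primitiveCharacter‖ ≤ (p : ℝ)⁻¹) →
      ∀ (K₀ : Type) [Field K₀] [NumberField K₀] (ε₀ : DirichletCharacter ℚ_[p] (NumberField.discr K₀).natAbs),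
        IsImaginaryQuadratic K₀ → Odd (NumberField.discr K₀) → NumberField.discr K₀ < -4 →
        ¬ ((3 : ℤ) ∣ NumberField.discr K₀) →
        (∀ q' : ℕ, q'.Prime → q' ∣ m → q' ≠ 2 → jacobiSym (NumberField.discr K₀) q' = τ q') →
        NumberField.discr K₀ % 8 = 5 → IsKroneckerCharacterOf K₀ ε₀ →
        ‖(k : ℚ_[p])⁻¹ * @generalizedBernoulli ℚ_[p] _ _
            (changeLevel (dvd_mul_right m (NumberField.discr K₀).natAbs) χ *
              changeLevel (dvd_mul_left (NumberField.discr K₀).natAbs m) ε₀).conductor ⟨conductor_ne_zero _⟩ k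
            (changeLevel (dvd_mul_right m (NumberField.discr K₀).natAbs) χ *
              changeLevel (dvd_mul_left (NumberField.discr K₀).natAbs m) ε₀).primitiveCharacter‖ ≤ (p : ℝ)⁻¹ :=
  flipRungTwo_six_of_jmlTwo_of_eight (jmlTwo_six_of_facts hA hQ) hEight

/-- **(FlipRungTwo⁶) ⟸ NF-A ∧ NF-Q ∧ (JMLTwoEight⁶)** (the e = 3 half as the modular-free interface of `…FlipRungTwoEightOfJML`, to be
discharged by w8 g10's `jmlTwoEight_six_of_facts`). [cite: Cohen1975, Thm. 3.1] [cite: Katz1973, §1.6 Cor. 1.6.2] -/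
theorem flipRungTwo_six_of_facts_of_jmlTwoEight
    (hA : Literature.NumberTheory.ModularForms.Cohen1975.thm31_cohenSeries_mem_halfIntModularForms)
    (hQ : Literature.NumberTheory.ModularForms.Katz1973_qExpansionPrinciple_allCusps)
    (hJ8 : ∀ (p : ℕ) [Fact p.Prime] (m : ℕ) [NeZero m] (χ : DirichletCharacter ℚ_[p] m) (k : ℕ),
      (p = 7 ∨ p = 11 ∨ p = 19 ∨ p = 43 ∨ p = 67 ∨ p = 163) →
      m.Coprime p → χ.IsPrimitive → χ.IsQuadratic → (k = (p + 1) / 4 ∨ k = (3 * p - 1) / 4) →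
      2 ≤ k → k ≤ p - 2 → χ (-1) * (-1) ^ k = -1 → 2 ∣ m → 8 ∣ m →
      ∀ (τ : ℕ → ℤ), (∀ q' : ℕ, q'.Prime → q' ∣ m → q' ≠ 2 → (τ q' = 1 ∨ τ q' = -1)) →
      ∀ (a : ℕ → ℚ),
        (∀ i : ℕ, (m / 8 ∣ i ∧
            (∀ q' : ℕ, q'.Prime → q' ∣ m → q' ≠ 2 →
              jacobiSym (-((i / (m / 8) : ℕ) : ℤ)) q' = τ q' * jacobiSym 2 q') ∧
            ¬ 3 ∣ i / (m / 8)) → a i = cohenH k i) →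
        (∀ i : ℕ, ¬ (m / 8 ∣ i ∧
            (∀ q' : ℕ, q'.Prime → q' ∣ m → q' ≠ 2 →
              jacobiSym (-((i / (m / 8) : ℕ) : ℤ)) q' = τ q' * jacobiSym 2 q') ∧
            ¬ 3 ∣ i / (m / 8)) → a i = 0) →
      ∃ N : ℕ, ¬ p ∣ N ∧ 2 ∣ N ∧
        ∀ c : ℕ, c % 2 = 1 →
          (∀ n : ℕ, n % 8 = c % 8 →
            ∃ y : ℂ, (∃ j : ℕ, IsIntegral ℤ ((N : ℂ) ^ j * y)) ∧ ((a (8 * n) : ℚ) : ℂ) = (p : ℂ) * y) →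
          ∀ n : ℕ, n % 2 = 1 →
            ∃ y : ℂ, (∃ j : ℕ, IsIntegral ℤ ((N : ℂ) ^ j * y)) ∧ ((a (8 * n) : ℚ) : ℂ) = (p : ℂ) * y) :
    ∀ (p : ℕ) [Fact p.Prime] (m : ℕ) [NeZero m] (χ : DirichletCharacter ℚ_[p] m) (k : ℕ),
      (p = 7 ∨ p = 11 ∨ p = 19 ∨ p = 43 ∨ p = 67 ∨ p = 163) →
      m.Coprime p → χ.IsPrimitive → χ.IsQuadratic → (k = (p + 1) / 4 ∨ k = (3 * p - 1) / 4) →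
      2 ≤ k → k ≤ p - 2 → χ (-1) * (-1) ^ k = -1 → 2 ∣ m →
      ∀ (τ : ℕ → ℤ), (∀ q' : ℕ, q'.Prime → q' ∣ m → q' ≠ 2 → (τ q' = 1 ∨ τ q' = -1)) →
      (∀ (K₀ : Type) [Field K₀] [NumberField K₀] (ε₀ : DirichletCharacter ℚ_[p] (NumberField.discr K₀).natAbs),
        IsImaginaryQuadratic K₀ → Odd (NumberField.discr K₀) → NumberField.discr K₀ < -4 →
        ¬ ((3 : ℤ) ∣ NumberField.discr K₀) →
        (∀ q' : ℕ, q'.Prime → q' ∣ m → q' ≠ 2 → jacobiSym (NumberField.discr K₀) q' = τ q') →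
        NumberField.discr K₀ % 8 = 1 → IsKroneckerCharacterOf K₀ ε₀ →
        ‖(k : ℚ_[p])⁻¹ * @generalizedBernoulli ℚ_[p] _ _
            (changeLevel (dvd_mul_right m (NumberField.discr K₀).natAbs) χ *
              changeLevel (dvd_mul_left (NumberField.discr K₀).natAbs m) ε₀).conductor ⟨conductor_ne_zero _⟩ k
            (changeLevel (dvd_mul_right m (NumberField.discr K₀).natAbs) χ *
              changeLevel (dvd_mul_left (NumberField.discr K₀).natAbs m) ε₀).primitiveCharacter‖ ≤ (p : ℝ)⁻¹) →
      ∀ (K₀ : Type) [Field K₀] [NumberField K₀] (ε₀ : DirichletCharacter ℚ_[p] (NumberField.discr K₀).natAbs),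
        IsImaginaryQuadratic K₀ → Odd (NumberField.discr K₀) → NumberField.discr K₀ < -4 →
        ¬ ((3 : ℤ) ∣ NumberField.discr K₀) →
        (∀ q' : ℕ, q'.Prime → q' ∣ m → q' ≠ 2 → jacobiSym (NumberField.discr K₀) q' = τ q') →
        NumberField.discr K₀ % 8 = 5 → IsKroneckerCharacterOf K₀ ε₀ →
        ‖(k : ℚ_[p])⁻¹ * @generalizedBernoulli ℚ_[p] _ _
            (changeLevel (dvd_mul_right m (NumberField.discr K₀).natAbs) χ *
              changeLevel (dvd_mul_left (NumberField.discr K₀).natAbs m) ε₀).conductor ⟨conductor_ne_zero _⟩ k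
            (changeLevel (dvd_mul_right m (NumberField.discr K₀).natAbs) χ *
              changeLevel (dvd_mul_left (NumberField.discr K₀).natAbs m) ε₀).primitiveCharacter‖ ≤ (p : ℝ)⁻¹ :=
  flipRungTwo_six_of_jmlTwo_of_eight (jmlTwo_six_of_facts hA hQ) (rungTwoEight_six_of_jmlTwoEight hJ8)

/-- **(FlipRungTwo⁶) ⟸ `stub_printsCohenKatzCusps` ∧ (JMLTwoEight⁶)** — the shape an interim v30 `_of` consumes:
`stub_flipRungTwo := flipRungTwo_six_of_printsCohenKatzCusps_of_jmlTwoEight stub_printsCohenKatzCusps stub_jmlTwoEight`.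
[cite: Cohen1975, Thm. 3.1] [cite: Katz1973, §1.6 Cor. 1.6.2] -/
theorem flipRungTwo_six_of_printsCohenKatzCusps_of_jmlTwoEight
    (h : (Literature.NumberTheory.ModularForms.Cohen1975.thm31_cohenSeries_mem_halfIntModularForms ∧
      (∀ (p : ℕ) [Fact p.Prime] (N : ℕ), Literature.NumberTheory.ModularForms.ModP.WeightCongruence p N ∧
        Literature.NumberTheory.ModularForms.ModP.ThetaFiltration p N) ∧
      Literature.NumberTheory.ModularForms.Katz1973_qExpansionPrinciple_allCusps))
    (hJ8 : ∀ (p : ℕ) [Fact p.Prime] (m : ℕ) [NeZero m] (χ : DirichletCharacter ℚ_[p] m) (k : ℕ),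
      (p = 7 ∨ p = 11 ∨ p = 19 ∨ p = 43 ∨ p = 67 ∨ p = 163) →
      m.Coprime p → χ.IsPrimitive → χ.IsQuadratic → (k = (p + 1) / 4 ∨ k = (3 * p - 1) / 4) →
      2 ≤ k → k ≤ p - 2 → χ (-1) * (-1) ^ k = -1 → 2 ∣ m → 8 ∣ m →
      ∀ (τ : ℕ → ℤ), (∀ q' : ℕ, q'.Prime → q' ∣ m → q' ≠ 2 → (τ q' = 1 ∨ τ q' = -1)) →
      ∀ (a : ℕ → ℚ),
        (∀ i : ℕ, (m / 8 ∣ i ∧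
            (∀ q' : ℕ, q'.Prime → q' ∣ m → q' ≠ 2 →
              jacobiSym (-((i / (m / 8) : ℕ) : ℤ)) q' = τ q' * jacobiSym 2 q') ∧
            ¬ 3 ∣ i / (m / 8)) → a i = cohenH k i) →
        (∀ i : ℕ, ¬ (m / 8 ∣ i ∧
            (∀ q' : ℕ, q'.Prime → q' ∣ m → q' ≠ 2 →
              jacobiSym (-((i / (m / 8) : ℕ) : ℤ)) q' = τ q' * jacobiSym 2 q') ∧
            ¬ 3 ∣ i / (m / 8)) → a i = 0) →
      ∃ N : ℕ, ¬ p ∣ N ∧ 2 ∣ N ∧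
        ∀ c : ℕ, c % 2 = 1 →
          (∀ n : ℕ, n % 8 = c % 8 →
            ∃ y : ℂ, (∃ j : ℕ, IsIntegral ℤ ((N : ℂ) ^ j * y)) ∧ ((a (8 * n) : ℚ) : ℂ) = (p : ℂ) * y) →
          ∀ n : ℕ, n % 2 = 1 →
            ∃ y : ℂ, (∃ j : ℕ, IsIntegral ℤ ((N : ℂ) ^ j * y)) ∧ ((a (8 * n) : ℚ) : ℂ) = (p : ℂ) * y) :
    ∀ (p : ℕ) [Fact p.Prime] (m : ℕ) [NeZero m] (χ : DirichletCharacter ℚ_[p] m) (k : ℕ),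
      (p = 7 ∨ p = 11 ∨ p = 19 ∨ p = 43 ∨ p = 67 ∨ p = 163) →
      m.Coprime p → χ.IsPrimitive → χ.IsQuadratic → (k = (p + 1) / 4 ∨ k = (3 * p - 1) / 4) →
      2 ≤ k → k ≤ p - 2 → χ (-1) * (-1) ^ k = -1 → 2 ∣ m →
      ∀ (τ : ℕ → ℤ), (∀ q' : ℕ, q'.Prime → q' ∣ m → q' ≠ 2 → (τ q' = 1 ∨ τ q' = -1)) →
      (∀ (K₀ : Type) [Field K₀] [NumberField K₀] (ε₀ : DirichletCharacter ℚ_[p] (NumberField.discr K₀).natAbs),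
        IsImaginaryQuadratic K₀ → Odd (NumberField.discr K₀) → NumberField.discr K₀ < -4 →
        ¬ ((3 : ℤ) ∣ NumberField.discr K₀) →
        (∀ q' : ℕ, q'.Prime → q' ∣ m → q' ≠ 2 → jacobiSym (NumberField.discr K₀) q' = τ q') →
        NumberField.discr K₀ % 8 = 1 → IsKroneckerCharacterOf K₀ ε₀ →
        ‖(k : ℚ_[p])⁻¹ * @generalizedBernoulli ℚ_[p] _ _
            (changeLevel (dvd_mul_right m (NumberField.discr K₀).natAbs) χ *
              changeLevel (dvd_mul_left (NumberField.discr K₀).natAbs m) ε₀).conductor ⟨conductor_ne_zero _⟩ k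
            (changeLevel (dvd_mul_right m (NumberField.discr K₀).natAbs) χ *
              changeLevel (dvd_mul_left (NumberField.discr K₀).natAbs m) ε₀).primitiveCharacter‖ ≤ (p : ℝ)⁻¹) →
      ∀ (K₀ : Type) [Field K₀] [NumberField K₀] (ε₀ : DirichletCharacter ℚ_[p] (NumberField.discr K₀).natAbs),
        IsImaginaryQuadratic K₀ → Odd (NumberField.discr K₀) → NumberField.discr K₀ < -4 →
        ¬ ((3 : ℤ) ∣ NumberField.discr K₀) →
        (∀ q' : ℕ, q'.Prime → q' ∣ m → q' ≠ 2 → jacobiSym (NumberField.discr K₀) q' = τ q') →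
        NumberField.discr K₀ % 8 = 5 → IsKroneckerCharacterOf K₀ ε₀ →
        ‖(k : ℚ_[p])⁻¹ * @generalizedBernoulli ℚ_[p] _ _
            (changeLevel (dvd_mul_right m (NumberField.discr K₀).natAbs) χ *
              changeLevel (dvd_mul_left (NumberField.discr K₀).natAbs m) ε₀).conductor ⟨conductor_ne_zero _⟩ k
            (changeLevel (dvd_mul_right m (NumberField.discr K₀).natAbs) χ *
              changeLevel (dvd_mul_left (NumberField.discr K₀).natAbs m) ε₀).primitiveCharacter‖ ≤ (p : ℝ)⁻¹ :=
  flipRungTwo_six_of_facts_of_jmlTwoEight h.1 h.2.2 hJ8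

end Summit.BirchSwinnertonDyer.BirchSwinnertonDyer.Theorems.PrintCFram.FlipRung

end
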